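import Summits.Ventures.CertifiedManyBodySolver.Downfold.EmeryFermiSurfaceHarmonics
import Summits.Ventures.CertifiedManyBodySolver.Downfold.EmeryBoxesHg1201P10DirectDD
import HarnessLib

/-!
# THE `t_dd` BUDGET LINE OF THE P = 0 BOX: for EVERY member of box #19's typed σ companion `emeryBoxHg1201` (HgBa₂CuO₄,
# P = 0; t_pp′ an interval) and any direct Cu–Cu hopping `−0.02 ≤ t_dd ≤ 0` eV (printed −0.0131 on the P = 0 neutral pair
# row), the exact higher Fermi-surface harmonics generated by `t_dd` are ≤ 0.5 % (`t″`) and ≤ 0.3 % (`t‴`) of `t`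
# (INFL-3to1-B §B.99 (f); companion of `EmeryBoxesHg1201P10DirectDD` — the @10 GPa half of the pair)

Venture CertifiedManyBodySolver, cell `pub/hubbard-downfold` (stage S1), seat hubbard-downfold-mod-4 (technique B,
g44); namespace `Summit.Ventures.CertifiedManyBodySolver.Downfold.Emery`. Everything PROVED (0 sorry, no certificate).

OBJECT. Run-1's P = 0 neutral three-band row of HgBa₂CuO₄ prints the pair `(t_pp′, t_dd) = (0.2084, −0.0131)` eV — the
like-for-like partner of the @10 GPa pair `(0.1156, +0.0687)` (router/BOXES/HgBa2CuO4.md §REDUCTION-B v0.4). On the typed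
P = 0 box (`Δ ∈ [1.4, 2.5]`, `t_pd ∈ [1.12, 1.32]`, `t_pp ∈ [0.64, 0.85]`, `t_pp′ ∈ [0.161, 0.208]` eV; every σ Fermi energy
≤ 4089/2000 < 3), for every `−1/50 ≤ t_dd ≤ 0` and every `ε ∈ [0, 3]`: `hg1201Box_ddT_lower` — `ddT ≥ 24/5`;
`hg1201Box_tdd_tppp_ratio` — **`|t‴/t| ≤ 3/1000`** with `ddT3 ≤ 0` (a NEGATIVE `t_dd` gives a `t‴` of the sign opposite to
the @10 GPa row's); `hg1201Box_tdd_tpp_ratio` — **`|t″/t| ≤ 1/200`**. READING (value-free): both halves of the pressure pair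
are read EXACTLY; the printed `t_dd` of either sign generates no one-band harmonic above 1.5 % of `t` (@10) / 0.5 % (@0).

WHAT THIS IS NOT: statements about HgBa₂CuO₄ — SCREENING-GRADE typed box; `U = 0` kinematics; bounds uniform in ε; no box edit.
-/

noncomputable section

namespace Summit.Ventures.CertifiedManyBodySolver.Downfold.Emery

open Real Set

/-- **The contour scale on the P = 0 box**: `ddT ≥ 24/5` for every member, every `−1/50 ≤ t_dd ≤ 0` and every
`ε ∈ [0, 3]`. [folklore] -/
theorem hg1201Box_ddT_lower {Δ a b c d ε : ℝ} (hΔ : Δ ∈ Icc ((7 : ℝ) / 5) ((5 : ℝ) / 2))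
    (ha : a ∈ Icc ((28 : ℝ) / 25) ((33 : ℝ) / 25)) (hb : b ∈ Icc ((16 : ℝ) / 25) ((17 : ℝ) / 20))
    (hc : c ∈ Icc ((161 : ℝ) / 1000) ((26 : ℝ) / 125)) (hd : d ∈ Icc (-(1 : ℝ) / 50) 0) (hε : ε ∈ Icc (0 : ℝ) 3) :
    (24 : ℝ) / 5 ≤ ddT Δ a b c d ε := by
  obtain ⟨hD1, hD2⟩ := hΔ; obtain ⟨ha1, ha2⟩ := ha; obtain ⟨hb1, hb2⟩ := hb; obtain ⟨hc1, hc2⟩ := hc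
  obtain ⟨hd1, hd2⟩ := hd; obtain ⟨he1, he2⟩ := hε
  rw [ddT_expand]
  have hasq : ((28 : ℝ) / 25) ^ 2 ≤ a ^ 2 := pow_le_pow_left₀ (by norm_num) ha1 2
  have hbsq : ((16 : ℝ) / 25) ^ 2 ≤ b ^ 2 := pow_le_pow_left₀ (by norm_num) hb1 2
  have hbsq' : b ^ 2 ≤ ((17 : ℝ) / 20) ^ 2 := pow_le_pow_left₀ (by linarith) hb2 2
  have hcsq : ((161 : ℝ) / 1000) ^ 2 ≤ c ^ 2 := pow_le_pow_left₀ (by norm_num) hc1 2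
  -- (1) d–p weight: a² − cε ≥ 1.2544 − 0.624
  have h1 : (3152 : ℝ) / 5000 ≤ a ^ 2 - c * ε := by nlinarith
  have hE0 : (7 : ℝ) / 5 ≤ Δ + ε := by linarith
  have h2 : (7 : ℝ) / 5 * ((3152 : ℝ) / 5000) ≤ (Δ + ε) * (a ^ 2 - c * ε) :=
    mul_le_mul hE0 h1 (by norm_num) (by linarith)
  -- (2) oxygen weight
  have h3 : ((28 : ℝ) / 25) ^ 2 * ((16 : ℝ) / 25 + (161 : ℝ) / 1000) ≤ a ^ 2 * (b + c) :=
    mul_le_mul hasq (by linarith) (by norm_num) (by nlinarith)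
  have h4 : 0 ≤ ε * (b ^ 2 - c ^ 2) := mul_nonneg he1 (by nlinarith)
  -- (3) t_dd terms: −d((Δ+ε)² + 4(Δ+ε)c) ≥ 0 and 6d(b² − c²) ≥ −6/50·(b² − c²)
  have h5 : 0 ≤ -(d * ((Δ + ε) ^ 2 + 4 * (Δ + ε) * c)) := by
    have : 0 ≤ (Δ + ε) ^ 2 + 4 * (Δ + ε) * c := by nlinarith
    nlinarith
  have h6 : -((1 : ℝ) / 50) * (6 * (((17 : ℝ) / 20) ^ 2)) ≤ 6 * d * (b ^ 2 - c ^ 2) := by nlinarith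
  nlinarith

/-- **THE `t‴` LINE (P = 0 box).** `ddT3 ≤ 0` and `|t‴/t| = |ddT3/ddT| ≤ 3/1000`. [folklore] -/
theorem hg1201Box_tdd_tppp_ratio {Δ a b c d ε : ℝ} (hΔ : Δ ∈ Icc ((7 : ℝ) / 5) ((5 : ℝ) / 2))
    (ha : a ∈ Icc ((28 : ℝ) / 25) ((33 : ℝ) / 25)) (hb : b ∈ Icc ((16 : ℝ) / 25) ((17 : ℝ) / 20))
    (hc : c ∈ Icc ((161 : ℝ) / 1000) ((26 : ℝ) / 125)) (hd : d ∈ Icc (-(1 : ℝ) / 50) 0) (hε : ε ∈ Icc (0 : ℝ) 3) :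
    ddT3 b c d ≤ 0 ∧ |ddT3 b c d / ddT Δ a b c d ε| ≤ (3 : ℝ) / 1000 := by
  have hT := hg1201Box_ddT_lower hΔ ha hb hc hd hε
  obtain ⟨hb1, hb2⟩ := hb; obtain ⟨hc1, hc2⟩ := hc; obtain ⟨hd1, hd2⟩ := hd
  have hTpos : 0 < ddT Δ a b c d ε := by linarith
  have hbc : 0 ≤ b ^ 2 - c ^ 2 := by nlinarith
  have hbc' : b ^ 2 - c ^ 2 ≤ ((17 : ℝ) / 20) ^ 2 := by nlinarith
  have h3np : ddT3 b c d ≤ 0 := by unfold ddT3; exact mul_nonpos_of_nonpos_of_nonneg hd2 hbc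
  have hcsq : ((161 : ℝ) / 1000) ^ 2 ≤ c ^ 2 := pow_le_pow_left₀ (by norm_num) hc1 2
  have hbc'' : b ^ 2 - c ^ 2 ≤ ((17 : ℝ) / 20) ^ 2 - ((161 : ℝ) / 1000) ^ 2 := by nlinarith
  have h3lo : -((1 : ℝ) / 50 * (((17 : ℝ) / 20) ^ 2 - ((161 : ℝ) / 1000) ^ 2)) ≤ ddT3 b c d := by
    unfold ddT3; nlinarith [mul_le_mul_of_nonneg_left hbc'' (show (0:ℝ) ≤ -d by linarith)]
  refine ⟨h3np, ?_⟩
  rw [abs_div, abs_of_nonpos h3np, abs_of_pos hTpos, div_le_div_iff₀ hTpos (by norm_num)]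
  nlinarith

/-- **THE `t″` LINE (P = 0 box).** `|t″/t| = |ddT2/ddT| ≤ 1/200`. [folklore] -/
theorem hg1201Box_tdd_tpp_ratio {Δ a b c d ε : ℝ} (hΔ : Δ ∈ Icc ((7 : ℝ) / 5) ((5 : ℝ) / 2))
    (ha : a ∈ Icc ((28 : ℝ) / 25) ((33 : ℝ) / 25)) (hb : b ∈ Icc ((16 : ℝ) / 25) ((17 : ℝ) / 20))
    (hc : c ∈ Icc ((161 : ℝ) / 1000) ((26 : ℝ) / 125)) (hd : d ∈ Icc (-(1 : ℝ) / 50) 0) (hε : ε ∈ Icc (0 : ℝ) 3) :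
    |ddT2 Δ b c d ε / ddT Δ a b c d ε| ≤ (1 : ℝ) / 200 := by
  have hT := hg1201Box_ddT_lower hΔ ha hb hc hd hε
  obtain ⟨hD1, hD2⟩ := hΔ; obtain ⟨hb1, hb2⟩ := hb; obtain ⟨hc1, hc2⟩ := hc; obtain ⟨hd1, hd2⟩ := hd
  obtain ⟨he1, he2⟩ := hε
  have hTpos : 0 < ddT Δ a b c d ε := by linarith
  have hbsq : ((16 : ℝ) / 25) ^ 2 ≤ b ^ 2 := pow_le_pow_left₀ (by norm_num) hb1 2
  have hbsq' : b ^ 2 ≤ ((17 : ℝ) / 20) ^ 2 := pow_le_pow_left₀ (by linarith) hb2 2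
  have hcsq' : c ^ 2 ≤ ((26 : ℝ) / 125) ^ 2 := pow_le_pow_left₀ (by linarith) hc2 2
  -- the bracket (Δ + ε)c − 2(b² − c²) ∈ [−1.168, 0.412]
  have hin_lo : -((117 : ℝ) / 100) ≤ (Δ + ε) * c - 2 * (b ^ 2 - c ^ 2) := by nlinarith
  have hin_hi : (Δ + ε) * c - 2 * (b ^ 2 - c ^ 2) ≤ (42 : ℝ) / 100 := by nlinarith
  have h2abs : |ddT2 Δ b c d ε| ≤ (1 : ℝ) / 50 * ((117 : ℝ) / 100) := by
    unfold ddT2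
    rw [abs_mul]
    have hdabs : |d| ≤ (1 : ℝ) / 50 := by rw [abs_of_nonpos hd2]; linarith
    have hbr : |(Δ + ε) * c - 2 * (b ^ 2 - c ^ 2)| ≤ (117 : ℝ) / 100 := abs_le.2 ⟨by linarith, by linarith⟩
    exact mul_le_mul hdabs hbr (abs_nonneg _) (by norm_num)
  rw [abs_div, abs_of_pos hTpos, div_le_div_iff₀ hTpos (by norm_num)]
  nlinarith [abs_nonneg (ddT2 Δ b c d ε)]

end Summit.Ventures.CertifiedManyBodySolver.Downfold.Emery
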